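import Literature.NumberTheory.EllipticCurves.MazurRubin2015.KummerImageGoodReduction
import Literature.NumberTheory.EllipticCurves.QuadraticTwist
import HarnessLib

/-!
# Mazur–Rubin 2015, Thm. 3.1 / §6 Case 5 (twisted paragraph): the local Kummer conditions of the
# QUADRATIC TWISTS of two `p`-congruent elliptic curves agree at a place ABOVE `p` where both
# UNTWISTED curves have GOOD reduction (`k = 1`, `e(v|p) < p − 1`) — the twist may be RAMIFIED at `v`

Topic `NumberTheory/EllipticCurves`, sub-directory `MazurRubin2015` (author–year); namespace
`Literature.NumberTheory.EllipticCurves.MazurRubin2015`. ONE named fact (`def … : Prop`, D-0014: a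
published theorem with proof, transcribed, not proved here) + proved corollaries. Sibling of
`KummerImageGoodReduction.lean` (same source, same vocabulary), which transcribes the UNTWISTED case
(`χ = 1`: both curves good at `v`) and leaves `-- TODO(general form): … and the twisted statement for E^χ`;
this file is that twisted statement. Written by seat `bsd-addord-k1-c2` (cell `bsd-addord`,
run/shared/lean/pub/bsd-addord/) for the rows of the Birch–Swinnerton-Dyer residual partition where `E`
has ADDITIVE, potentially good reduction at `p` with semistability defect `2` (Kodaira `I₀*`):
`E ≅ V^{(p*)}` is the quadratic twist by `p* = (−1)^{(p−1)/2} p` of a curve `V` with GOOD reduction at `p`,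
and a `p`-congruent partner `E' ≅ V'^{(p*)}` of the same kind makes the place `p` FREE in the congruence /
visibility certificate `WeierstrassCurve.exists_sha_ne_zero_of_congr_of_le_off`
(`CongruenceVisibilityComparison.lean`) exactly as kind (v) of `KummerImageGoodReduction.lean` does for
curves good at `p`. HONEST FRAMING of that use: nothing here proves the Birch–Swinnerton-Dyer conjecture;
the fact is a per-place comparison of local conditions, consumed per pair.

## Source (B. Mazur, K. Rubin, *Selmer companion curves*, Trans. Amer. Math. Soc. 367 (2015) 401–421 =
## arXiv:1203.0620; held text = the arXiv source, store key `paper:arxiv-1203.0620`, whose running item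
## numbers are quoted in brackets; the journal numbers sections — Thm. 3.1 is the main theorem of §3 — and
## items: JOURNAL CONCORDANCE (version of record, Trans. AMS 367) Thm. [8] = Thm. 3.1 (pp. 404–405) ·
## Remark [9] = Remark 3.2 (p. 405) · Remark [12] = Remark 3.5 (p. 405) · Prop. [27] = Prop. 5.8 (p. 411) ·
## Remark [28] = Remark 5.9 (p. 411) · Thm. [29] = Thm. 6.1 (pp. 411–412) · Def. [30] = Def. 6.2 (p. 412) ·
## proof of Thm. 6.1 Case 5 with the twisted paragraph = p. 413 · proof of Thm. 3.1 (Raynaud paragraph) =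
## p. 414, where Raynaud is cited as printed «[20, §3.5.5]» ([20] = Bull. Soc. Math. France 102 (1974)))

Notation (end of §1): "`𝒳(K) := Hom(G_K, {±1})` the group of quadratic characters of `K`"; "for every
quadratic character `χ` of `K`, we denote by `E^χ` the quadratic twist of `E` by `χ`."
**Theorem 3.1 [8] (pp. 404–405).** "Suppose `E₁` and `E₂` are elliptic curves over `K`. Let `S_i` be the set
of primes of `K` where `E_i` has potentially multiplicative reduction. Let `m = p^{k+1}` if `p ≤ 3`, and
`m = p^k` if `p > 3`. Suppose further that: (i) there is a `G_K`-isomorphism `E₁[m] ≅ E₂[m]`, (ii) `S₁ = S₂`,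
(iii) for all `𝔩 ∈ S₁ = S₂`, the isomorphism of (i) sends `𝒞_{E₁/K_𝔩}[m]` to `𝒞_{E₂/K_𝔩}[m]`, (iv) for every
`𝔭` of `K` above `p`, either (a) `𝔭 ∈ S₁ = S₂`, or (b) `k = 1`, `E₁` and `E₂` have good reduction at `𝔭`, and
the ramification degree `e(𝔭/p)` is less than `p − 1`. Then for every finite extension `F` of `K`, and every
`χ ∈ 𝒳(F)`, there is a canonical isomorphism `Sel_{p^k}(E₁^χ/F) ≅ Sel_{p^k}(E₂^χ/F)`."
**Remark [9] (= Remark 3.2, p. 405).** "The proof of Theorem 3.1 will show that `Sel_{p^k}(E₁^χ/F)`,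
`Sel_{p^k}(E₂^χ/F)` are actually equal inside `H¹(F, E₁^χ[p^k]) = H¹(F, E₂^χ[p^k])`, where we use the
isomorphism `E₁[p^k] ≅ E₂[p^k]` to identify `H¹(F, E₁^χ[p^k])` with `H¹(F, E₂^χ[p^k])`."
§6, after **Definition [30] (= Def. 6.2, p. 412)** (the `p^k`-Selmer group): "We will show that under the
hypotheses of Theorems 3.1 and [29] (= Thm. 6.1, pp. 411–412), with these identifications, for every `v` and
for every `χ ∈ 𝒳(K_v)`, the images of the horizontal Kummer maps `E_i^χ(K_v) → H¹(K_v, E_i[p^k])`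
(`i = 1, 2`) are equal. It will then follow from the definition that `Sel_{p^k}(E₁^χ/K) = Sel_{p^k}(E₂^χ/K)`
inside `H¹(K, E₁[p^k]) = H¹(K, E₂[p^k])` for every `χ`."
**Proof of Theorem [29] = Thm. 6.1, Case 5** (p. 413; VERBATIM, the twisted paragraph): "`v ∣ p`, `p > 2`,
`E₁` and `E₂` have good reduction at `v`, and the isomorphism `E₁[p^k] ≅ E₂[p^k]` extends to an isomorphism
`𝓔₁[p^k] ≅ 𝓔₂[p^k]`. In this case Proposition [27] (= Prop. 5.8, p. 411) shows that
`image(κ_{E₁/K_v}) = image(κ_{E₂/K_v})`. More generally, suppose `χ ∈ 𝒳(K_v)`, and let `L` be the quadratic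
extension of `K_v` cut out by `χ`. Then Proposition [27] shows that `image(κ_{E₁/L}) = image(κ_{E₂/L})`, and
this isomorphism preserves the natural action of `Gal(L/K_v)`. Let `σ` denote the nontrivial element of
`Gal(L/K_v)`, and for every `ℤ[Gal(L/K_v)]`-module `M`, define `M⁻ := {m ∈ M : m^σ = −m}`. Since `p > 2`, one
verifies easily using the Hochschild–Serre spectral sequence that for `i = 1, 2` we have
`E_i^χ(K_v)/p^k E_i^χ(K_v) = (E_i(L)/p^k E_i(L))⁻`, `H¹(K_v, E_i^χ[p^k]) = H¹(L, E_i[p^k])⁻`,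
`image(κ_{E_i^χ/K_v}) = image(κ_{E_i/L})⁻` and we conclude that
`image(κ_{E₁^χ/K_v}) = image(κ_{E₂^χ/K_v})`."
**Proof of Theorem 3.1** (last paragraph of §6, p. 414): "Suppose `k = 1`, `𝔭 ∣ p`, `E₁, E₂` have good
reduction at `𝔭`, and the ramification `e(𝔭/p) < p − 1` (so in particular `p > 2`). By Raynaud's theorem
[20, §3.5.5], the group scheme `𝓔_i[p]` is determined by the Galois module `E_i[p]`. Hence in this case the
isomorphism `E₁[p] ≅ E₂[p]` necessarily extends to an isomorphism `𝓔₁[p] ≅ 𝓔₂[p]`." (Proposition [27] =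
Prop. 5.8 and Remark [28] = Remark 5.9, p. 411, are quoted in `KummerImageGoodReduction.lean`.)

## Transcription (the tree's vocabulary = that of `KummerImageGoodReduction.lean` and
## `CongruenceVisibilityComparison.lean`)

* `K` a number field, `p` an odd prime (`k = 1`), `V`, `V'` = the printed `E₁`, `E₂`: elliptic curves
  over `K` with GOOD reduction at a finite place `v ∣ p` (`(p : 𝓞 K) ∈ v.asIdeal`) of ramification
  `e(v|p) = v.asIdeal.ramificationIdx ℤ < p − 1`.
* The quadratic character `χ`: a non-zero `d : K` (`χ = χ_d`, the character of `K(√d)/K`; `χ ∈ 𝒳(K)`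
  restricts to `χ ∈ 𝒳(K_v)`, possibly RAMIFIED at `v`, possibly trivial on `K_v` — every case is covered by
  "for every `χ ∈ 𝒳(K_v)`"). The twists `E₁^χ`, `E₂^χ`: ANY `K`-models `W = C • V.quadraticTwist d`,
  `W' = C' • V'.quadraticTwist d` (`WeierstrassCurve.quadraticTwist`, `QuadraticTwist.lean`: the curve
  `y² = x³ + d(b₂/4)x² + d²(b₄/2)x + d³(b₆/4)`, `K(√d)`-isomorphic to `V`; `C, C' : VariableChange K`
  arbitrary `K`-isomorphisms, since the Selmer group and the local Kummer images are transported along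
  `K`-isomorphisms of curves).
* "The isomorphism `E₁[p] ≅ E₂[p]`" and the identification `H¹(K_v, E₁^χ[p]) = H¹(K_v, E₂^χ[p])` it
  induces (through `E_i^χ[p] = E_i[p] ⊗ χ`): a `Γ_K`-equivariant additive isomorphism
  `θ : W'[p] ⥲ W[p]` of the geometric `p`-torsion of the TWISTS and its transport `θ_* = h1Equiv θ hθ` on
  `H¹(K, ·)`. This is the same datum: over `K(√d)` a `K(√d)`-isomorphism `φ : W ⥲ V` with
  `φ^σ = [χ(σ)] ∘ φ` identifies `W[p]` with `V[p] ⊗ χ`, so a `Γ_K`-isomorphism `V'[p] ⥲ V[p]` twists to a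
  `Γ_K`-isomorphism `W'[p] ⥲ W[p]` and conversely (`θ ↦ φ ∘ θ ∘ φ'⁻¹`; the signs `χ(σ) = ±1` commute with
  the additive map `θ`).
* "The images of the Kummer maps `κ_{E_i^χ/K_v}` are equal in `H¹(K_v, E₁^χ[p]) = H¹(K_v, E₂^χ[p])`" is read
  on GLOBAL classes through restriction, exactly as in the sibling file:
  `𝓢_v(W) = W.selmerLocalKer K_v p = ker(H¹(K, W[p]) → H¹(K_v, W(K̄_v)))` (`= res_v⁻¹(image κ_{W/K_v})` by
  Kummer exactness) and, since `res_v ∘ θ_* = θ_* ∘ res_v`, for every `c ∈ H¹(K, W'[p])`: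
  `c ∈ 𝓢_v(W') ↔ θ_* c ∈ 𝓢_v(W)`. THIS equivalence is what is stated — the conjunction of Case 5 (twisted
  paragraph) with the Raynaud paragraph (the `k = 1`, `e < p − 1` clause of Thm. 3.1 (iv)(b)), for
  restrictions of global classes (weaker than print: nothing is claimed about local classes that are
  not restrictions, or about `k ≥ 2`).
`-- TODO(general form): k ≥ 2 (hypothesis: the isomorphism E₁[p^k] ≅ E₂[p^k] EXTENDS to the finite flat`
`-- group schemes over 𝒪_{K_v}; Thm. [29] = 6.1 (iv)); twists by characters of order ℓ > 2 (Remark [12] = 3.5).`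

## Proved here

Nothing (statement-only file). The `hagree`-shaped projection `θ_* 𝓢_v(W') ≤ 𝓢_v(W)`, the `ℚ`-form
(ramification automatic, `e = 1 < p − 1` for odd `p`, `Fisher2016.ramificationIdx_int_rat_eq_one`) and the form
with the prime-indexed predicate `HasGoodReductionAtPrime p` of the untwisted curves
(`hasGoodReductionAtPrime_iff_hasGoodReductionAt_ringOfIntegers`) are one-line consequences left to the
consumers (first consumer: `Summits/BirchSwinnertonDyer/BirchSwinnertonDyer/Theorems/AdditiveBranchIMCGordTwoRankZeroCompanion.lean`).

## References

* [MazurRubin2015SelmerCompanions] B. Mazur, K. Rubin, Trans. Amer. Math. Soc. 367 (2015) 401–421, Thm. 3.1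
  [8] (pp. 404–405) and Remark 3.2 [9] following it (p. 405); §6 Definition 6.2 [30] (p. 412), proof of
  Thm. 6.1 [29] Case 5 with the twisted paragraph (p. 413), proof of Thm. 3.1 (p. 414); Prop. 5.8 [27] and
  Remark 5.9 [28] (p. 411) (bracketed numbers = running numbers of arXiv:1203.0620; the others = the
  journal's, version of record).
* M. Raynaud, *Schémas en groupes de type (p, …, p)*, Bull. Soc. Math. France 102 (1974) 241–280, Thm. 3.3.3,
  Cor. 3.3.6 — cited by Mazur–Rubin as printed «[20, §3.5.5]» (journal) = [raynaud] (arXiv).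
* B. Mazur, *Rational points of abelian varieties with values in towers of number fields*, Invent. Math. 18
  (1972) 183–266 (Mazur–Rubin's [rpav] = journal [14], behind Proposition 5.8 [27]).
-/

noncomputable section

open scoped Classical

open NumberField IsDedekindDomain Field WeierstrassCurve

namespace Literature.NumberTheory.EllipticCurves.MazurRubin2015

/-- **Mazur–Rubin, Trans. AMS 367 (2015), Thm. 3.1 with §6 proof of Thm. [29] = Thm. 6.1, Case 5 (twisted
paragraph, p. 413) and the Raynaud paragraph (p. 414)** (local Kummer conditions of the QUADRATIC TWISTS of two
`p`-congruent curves agree at a place above `p` where both untwisted curves have GOOD reduction and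
`e(v|p) < p − 1`), read on restrictions of global classes. For a number field `K`, an odd prime `p`,
elliptic curves `V`, `V'` over `K` (the printed `E₁`, `E₂`) with good reduction at a finite place `v ∣ p`
with `e(v|p) < p − 1`, a non-zero `d : K` (the quadratic character `χ = χ_d`, ANY — in particular possibly
ramified at `v`), `K`-models `W = C • V^{(d)}`, `W' = C' • V'^{(d)}` of the twists `E₁^χ`, `E₂^χ`, and a
`Γ_K`-equivariant isomorphism `θ : W'[p] ⥲ W[p]` (the `χ`-twist of "the isomorphism `E₁[p] ≅ E₂[p]`" of
hypothesis (i)): a class `c ∈ H¹(K, W'[p])` satisfies the local Kummer (Selmer) condition of `W'` at `v`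
iff `θ_* c` satisfies that of `W` at `v`. As printed (§6, proof of Thm. [29] = Thm. 6.1, Case 5, p. 413):
"More generally, suppose `χ ∈ 𝒳(K_v)`, and let `L` be the quadratic extension of `K_v` cut out by `χ`. Then
Proposition [27] [= Prop. 5.8, p. 411] shows that `image(κ_{E₁/L}) = image(κ_{E₂/L})`, and this isomorphism
preserves the natural action of `Gal(L/K_v)`. … Since `p > 2`, one verifies easily using the Hochschild–Serre
spectral sequence that for `i = 1, 2` we have … `image(κ_{E_i^χ/K_v}) = image(κ_{E_i/L})⁻` and we conclude that
`image(κ_{E₁^χ/K_v}) = image(κ_{E₂^χ/K_v})`"; and (proof of Thm. 3.1, p. 414) "Suppose `k = 1`, `𝔭 ∣ p`,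
`E₁, E₂` have good reduction at `𝔭`, and the ramification `e(𝔭/p) < p − 1` (so in particular `p > 2`). By
Raynaud's theorem [20, §3.5.5], the group scheme `𝓔_i[p]` is determined by the Galois module `E_i[p]`. Hence
in this case the isomorphism `E₁[p] ≅ E₂[p]` necessarily extends to an isomorphism `𝓔₁[p] ≅ 𝓔₂[p]`" — the
conclusion of Thm. 3.1 being "for every finite extension `F` of `K`, and every `χ ∈ 𝒳(F)`, there is a
canonical isomorphism `Sel_p(E₁^χ/F) ≅ Sel_p(E₂^χ/F)`" (equality inside `H¹`, Remark 3.2 = [9] after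
Thm. 3.1, p. 405). Named fact,
NOT proved here (finite flat group schemes / fppf cohomology / Raynaud's theorem are not in the tree).
The untwisted case `d = 1` is `selmerLocalKer_iff_of_goodReduction_above` (sibling file).
[cite: MazurRubin2015SelmerCompanions, Thm. 3.1 (conclusion for every χ ∈ 𝒳(F)) with hypothesis (iv)(b) and Remark 3.2 (pp. 404–405); §6 proof of Thm. 6.1 (= comp2) Case 5, twisted paragraph (p. 413), and proof of Thm. 3.1 (p. 414); Prop. 5.8 / Remark 5.9 (p. 411), Def. 6.2 (p. 412) = arXiv:1203.0620 items 8–9, 27–30] -/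
def selmerLocalKer_iff_of_twist_of_goodReduction_above : Prop :=
  ∀ {K : Type} [Field K] [NumberField K] (W W' V V' : WeierstrassCurve K) [W.IsElliptic]
    [W'.IsElliptic] [V.IsElliptic] [V'.IsElliptic] (p : ℕ) [Fact p.Prime], p ≠ 2 →
    ∀ (d : K) (C C' : VariableChange K), d ≠ 0 →
      C • V.quadraticTwist d = W → C' • V'.quadraticTwist d = W' →
    ∀ (θ : geomTorsion W' (p : ℤ) ≃+ geomTorsion W (p : ℤ))
      (hθ : ∀ (σ : absoluteGaloisGroup K) (P : geomTorsion W' (p : ℤ)), θ (σ • P) = σ • θ P)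
      (v : HeightOneSpectrum (𝓞 K)),
      (p : 𝓞 K) ∈ v.asIdeal → v.asIdeal.ramificationIdx ℤ < p - 1 →
      V.HasGoodReductionAt v → V'.HasGoodReductionAt v →
      ∀ c : galH1Torsion W' (p : ℤ),
        c ∈ selmerLocalKer W' (v.adicCompletion K) (p : ℤ) ↔
          h1Equiv θ hθ c ∈ selmerLocalKer W (v.adicCompletion K) (p : ℤ)

end Literature.NumberTheory.EllipticCurves.MazurRubin2015

end
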